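import Mathlib.Analysis.SpecialFunctions.Trigonometric.Chebyshev.Basic
import Mathlib.Analysis.SpecialFunctions.Complex.Arg
import Mathlib.Analysis.InnerProductSpace.PiL2
import HarnessLib

/-!
# Schoenberg positivity on the circle: the Chebyshev kernels `T_k(⟨x, y⟩)` on `S¹`

The `n = 2` case of Schoenberg's theorem (I. J. Schoenberg, *Positive definite functions on
spheres*, Duke Math. J. 9 (1942), Theorem 1): for every `k`, the zonal kernel
`(x, y) ↦ T_k(⟨x, y⟩)` on the unit circle `S¹ ⊂ ℝ²` (`T_k` the Chebyshev polynomial of the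
first kind, i.e. the Gegenbauer polynomial of `S¹` in the normalisation `T_k(1) = 1`) is positive
semidefinite: `Σ_{i,j} c_i c_j T_k(⟨p_i, p_j⟩) ≥ 0` for unit vectors `p_i` and real weights `c_i`.
Proof: writing `p_i = (cos θ_i, sin θ_i)` one has `⟨p_i, p_j⟩ = cos(θ_i - θ_j)`,
`T_k(cos(θ_i - θ_j)) = cos(kθ_i - kθ_j) = cos kθ_i cos kθ_j + sin kθ_i sin kθ_j`
(`Polynomial.Chebyshev.T_real_cos`), so the double sum is
`(Σ c_i cos kθ_i)² + (Σ c_i sin kθ_i)² ≥ 0`.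

This is the case excluded (`μ = 0`) from the tree's Fischer-pairing proof
`Literature.Analysis.SpecialFunctions.sum_mul_gegenbauerHom_nonneg` (`μ = (n-2)/2 > 0`, i.e.
`n ≥ 3`); it is the inner (hyperplane) kernel needed for the Bachoc–Vallentin three-point bound in
dimension `n = 3` (`S²`; Bachoc–Vallentin, J. AMS 21 (2008) §3, Remark 3.4 with `P_k^{n-1} = T_k`).

## References
* I. J. Schoenberg, Duke Math. J. 9 (1942) 96–108, Theorem 1. [`Schoenberg1942`]
* C. Bachoc, F. Vallentin, J. Amer. Math. Soc. 21 (2008) 909–924, §3. [`BachocVallentin2007`]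
-/

noncomputable section

open Finset Polynomial
open scoped RealInnerProductSpace

namespace Literature.Analysis.SpecialFunctions

/-- A unit vector of `ℝ²` is `(cos θ, sin θ)` for some angle `θ` (polar coordinates; `θ` = the
argument of `x₀ + i x₁`). [folklore] -/
private theorem exists_cos_sin_of_norm_eq_one (x : EuclideanSpace ℝ (Fin 2)) (hx : ‖x‖ = 1) :
    ∃ θ : ℝ, x 0 = Real.cos θ ∧ x 1 = Real.sin θ := by
  set z : ℂ := ⟨x 0, x 1⟩ with hz
  have hsq : (x 0) ^ 2 + (x 1) ^ 2 = 1 := by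
    have h := EuclideanSpace.real_norm_sq_eq x
    rw [hx, Fin.sum_univ_two] at h
    linarith
  have hnorm : ‖z‖ = 1 := by
    have h2 : ‖z‖ ^ 2 = 1 := by
      rw [Complex.sq_norm, Complex.normSq_apply]
      simp only [hz]
      nlinarith [hsq]
    have h0 : 0 ≤ ‖z‖ := norm_nonneg z
    nlinarith [h2, h0]
  have hz0 : z ≠ 0 := by
    intro h; rw [h, norm_zero] at hnorm; exact zero_ne_one hnorm
  refine ⟨Complex.arg z, ?_, ?_⟩
  · rw [Complex.cos_arg hz0, hnorm, div_one]
  · rw [Complex.sin_arg, hnorm, div_one]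

/-- The inner product of two unit vectors of `ℝ²` with polar angles `θ`, `φ` is `cos(θ - φ)`.
[folklore] -/
private theorem inner_eq_cos_sub {x y : EuclideanSpace ℝ (Fin 2)} {θ φ : ℝ}
    (hx0 : x 0 = Real.cos θ) (hx1 : x 1 = Real.sin θ) (hy0 : y 0 = Real.cos φ)
    (hy1 : y 1 = Real.sin φ) : ⟪x, y⟫ = Real.cos (θ - φ) := by
  rw [PiLp.inner_apply, Fin.sum_univ_two, Real.cos_sub]
  simp only [RCLike.inner_apply, conj_trivial, hx0, hx1, hy0, hy1]
  ring

/-- **Schoenberg positivity on `S¹` (Chebyshev kernels).** For unit vectors `p_i ∈ ℝ²` and real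
weights `c_i`: `0 ≤ Σ_{i,j ∈ s} c_i c_j T_k(⟨p_i, p_j⟩)`, where `T_k` is the Chebyshev polynomial of
the first kind; indeed the sum equals `(Σ_i c_i cos kθ_i)² + (Σ_i c_i sin kθ_i)²` in polar angles.
[cite: Schoenberg1942, Theorem 1 (the case of the circle)] -/
theorem sum_mul_chebyshevT_inner_nonneg {ι : Type*} (s : Finset ι) (k : ℕ)
    (p : ι → EuclideanSpace ℝ (Fin 2)) (hp : ∀ i ∈ s, ‖p i‖ = 1) (c : ι → ℝ) :
    0 ≤ ∑ i ∈ s, ∑ j ∈ s, c i * c j * (Chebyshev.T ℝ k).eval ⟪p i, p j⟫ := by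
  classical
  -- polar angles
  have hex : ∀ i ∈ s, ∃ θ : ℝ, p i 0 = Real.cos θ ∧ p i 1 = Real.sin θ :=
    fun i hi => exists_cos_sin_of_norm_eq_one (p i) (hp i hi)
  let θ : ι → ℝ := fun i => if h : i ∈ s then Classical.choose (hex i h) else 0
  have hθ : ∀ i ∈ s, p i 0 = Real.cos (θ i) ∧ p i 1 = Real.sin (θ i) := by
    intro i hi
    simp only [θ, dif_pos hi]
    exact Classical.choose_spec (hex i hi)
  -- rewrite each kernel value
  have hker : ∀ i ∈ s, ∀ j ∈ s, (Chebyshev.T ℝ k).eval ⟪p i, p j⟫ =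
      Real.cos (k * θ i) * Real.cos (k * θ j) + Real.sin (k * θ i) * Real.sin (k * θ j) := by
    intro i hi j hj
    rw [inner_eq_cos_sub (hθ i hi).1 (hθ i hi).2 (hθ j hj).1 (hθ j hj).2]
    rw [Chebyshev.T_real_cos (θ i - θ j) (k : ℤ), Int.cast_natCast, mul_sub, Real.cos_sub]
  have hsum : ∑ i ∈ s, ∑ j ∈ s, c i * c j * (Chebyshev.T ℝ k).eval ⟪p i, p j⟫ =
      (∑ i ∈ s, c i * Real.cos (k * θ i)) ^ 2 + (∑ i ∈ s, c i * Real.sin (k * θ i)) ^ 2 := by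
    rw [sq, sq, Finset.sum_mul_sum, Finset.sum_mul_sum, ← Finset.sum_add_distrib]
    refine Finset.sum_congr rfl fun i hi => ?_
    rw [← Finset.sum_add_distrib]
    refine Finset.sum_congr rfl fun j hj => ?_
    rw [hker i hi j hj]
    ring
  rw [hsum]
  positivity


end Literature.Analysis.SpecialFunctions
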